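import Summits.HodgeConjecture.HodgeConjecture.Theorems.K2E3WittFrameTools            -- (this seat) T2 F1: frame slots, `h(e_p, ·)`, `g⁻¹` on frame slots
import Summits.HodgeConjecture.HodgeConjecture.Theorems.K2E3HyperbolicPairTransport     -- ★ p856571 (this seat): `lineRootGL_partner_mem`, `lineRoot_partner_mulVec(_left)` for ANY hermitian `H`
import HarnessLib

/-!
# The BOUNDED ELIMINATION STEP for `U(σ, wittFormOn e Han)`, arbitrary kernel (crux H413, U12-g ∕ 13a road A, hand (T2) — `m = 2`, wildly ramified places)

Cell `hodgecm-mathlib`, Track B «K2-LIT», line `K2_E3_EllipticInputs`, 13a road A (line lead K2E3-p10 (g3), RULINGS #13); seat K2E3-p09 (g3).  THEOREMS ONLY;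
`--supports stmt-HodgeConjecture-24833 --as helper`.

This is ★ p856626 §3 (`exists_conj_eigen_of_pivot`, the case `W = J₀`, INTEGRAL transporters from a MAXIMAL pivot) rewritten for the Witt form `W = wittFormOn e Han`
with ANY kernel `Han` and a NEAR-maximal frame pivot: if `g ∈ U(σ, W)`, `(s, t)` is a frame × frame slot with `λ = g_{st} ≠ 0`, and all entries of `g` AND of `g⁻¹`
are bounded by `C · v(λ)` (`C ≥ 1`; ★ F2 `exists_frame_pivot` + ★ F1 `v_inv_apply_le` give `C = B⁴`), then there are `ω₁, ω₂ ∈ U(σ, W)` with ENTRIES BOUNDED BY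
`C · B` (`B ≥ 1` a bound for the entries of `W`) such that

  `(ω₁⁻¹ g ω₂) e_t = λ e_s`,  `(ω₁⁻¹ g ω₂) e_{rev t} = (σλ)⁻¹ e_{rev s}`      (`exists_conj_eigen_of_frame_pivot`).

The transporters are the same root elements as in ★ p856626 (`ω₁ = T_{e_{rev s}}(lineProj ẽ, h(e_s, ẽ))` with `ẽ = λ⁻¹ g e_t`, `ω₂ = T_{e_t}(lineProj x₂′, h(e_{rev t}, x₂′))`
with `x₂′ = (σλ)⁻¹ g⁻¹ e_{rev s}`), built by ★ `lineRootGL_partner_mem` for a general hermitian matrix; only the bookkeeping changes from `≤ 1` to `≤ C · B` (§1).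

HONEST LABEL: structure lemma; HC_CM is proved only modulo the 7 printed citations (2 remaining named inputs: hLiu418 = stmt-HodgeConjecture-24832, h413 =
stmt-HodgeConjecture-24833) until rung 0 closes.

References: F. Bruhat, J. Tits, *Groupes réductifs sur un corps local I* (1972), (4.4.3); J. Dieudonné, *La géométrie des groupes classiques* (1971), Chap. II §5;
V. Platonov, A. Rapinchuk, *Algebraic Groups and Number Theory* (1994), §3.1.
-/

set_option autoImplicit false
-- the mandated namespace repeats `HodgeConjecture.HodgeConjecture`, as in every `Theorems/*.lean` of this sub-problem
set_option linter.dupNamespace false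

noncomputable section

open scoped Valued WithZero Matrix MatrixGroups
open Matrix

namespace Summit.HodgeConjecture.HodgeConjecture.Cruxes.H413.K2E3WittBoundedStep

open Literature.NumberTheory.Automorphic Literature.NumberTheory.Automorphic.UnitaryGroup Literature.NumberTheory.Automorphic.HermitianLattice
open K2E3LocalUnitaryWitt K2E3WittCartanUnramified K2E3WittParabolicBlocks K2E3WittFrameTools K2E3HyperbolicPairTransport

/-! ## §1 Valuation bookkeeping for root elements of `W` -/

section Bounds

variable {K : Type*} [Field K] [Valued K ℤᵐ⁰] (σ : K →+* K) {N r m : ℕ} (e : WittIndex r m ≃ Fin N)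
  (hstd : ∀ x, (e x).val = Sum.elim (fun i : Fin r => i.val) (Sum.elim (fun u : Fin m => r + u.val) (fun j : Fin r => r + m + j.val)) x)
  (Han : Matrix (Fin m) (Fin m) K)

include hstd in
/-- **The entries of `W` are bounded by `B`** when `B ≥ 1` bounds the kernel (frame rows are `0∕1`). [cite: Dieudonne1971GroupesClassiques, Chap. I §11] -/
theorem v_wittFormOn_le {B : ℤᵐ⁰} (hB1 : 1 ≤ B) (hHanB : ∀ u u', Valued.v (Han u u') ≤ B) (p q : Fin N) : Valued.v (wittFormOn e Han p q) ≤ B := by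
  by_cases hp : ∀ u : Fin m, p ≠ e (Sum.inr (Sum.inl u))
  · rw [wittFormOn_apply_of_frame e hstd Han hp]
    split_ifs
    · rw [map_one]; exact hB1
    · rw [map_zero]; exact zero_le
  · push Not at hp
    obtain ⟨u, rfl⟩ := hp
    rw [wittFormOn_apply_inr_inl]
    rcases e.symm q with i | u' | j
    · change Valued.v (0 : K) ≤ B; rw [map_zero]; exact zero_le
    · exact hHanB u u'
    · change Valued.v (0 : K) ≤ B; rw [map_zero]; exact zero_le

omit [Valued K ℤᵐ⁰] in
include hstd in
/-- `hermRow(e_p)_j = [j = rev p]` at a frame slot. [cite: Dieudonne1971GroupesClassiques, Chap. II §5] -/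
theorem hermRow_single_frame {p : Fin N} (hp : ∀ u : Fin m, p ≠ e (Sum.inr (Sum.inl u))) (j : Fin N) :
    hermRow σ (wittFormOn e Han) (Pi.single p 1) j = if j = Fin.rev p then 1 else 0 := by
  rw [hermRow, Matrix.vecMul, dotProduct, Finset.sum_eq_single p]
  · rw [Function.comp_apply, Pi.single_eq_same, map_one, one_mul, wittFormOn_apply_of_frame e hstd Han hp]
  · intro i _ hi; rw [Function.comp_apply, Pi.single_eq_of_ne hi, map_zero, zero_mul]
  · exact fun h => absurd (Finset.mem_univ _) h

/-- **`v(hermRow(w)_j) ≤ C_w · B`** for `v(w_i) ≤ C_w`, `v(W_{pq}) ≤ B`. [cite: Dieudonne1971GroupesClassiques, Chap. II §5] -/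
theorem v_hermRow_le (hvσ : ∀ x, Valued.v (σ x) = Valued.v x) {B Cw : ℤᵐ⁰} (hW : ∀ p q, Valued.v (wittFormOn e Han p q) ≤ B) {w : Fin N → K}
    (hw : ∀ i, Valued.v (w i) ≤ Cw) (j : Fin N) : Valued.v (hermRow σ (wittFormOn e Han) w j) ≤ Cw * B := by
  rw [hermRow, Matrix.vecMul, dotProduct]
  refine Valued.v.map_sum_le fun i _ => ?_
  rw [map_mul, Function.comp_apply, hvσ]
  exact mul_le_mul' (hw i) (hW i j)

include hstd in
/-- **Root elements with bounded data are bounded**: for a frame slot `p`, `v(w_i) ≤ C`, `v(z) ≤ C` (`C, B ≥ 1`, `v(W) ≤ B`): `v(T_{e_p}(w, z)_{ij}) ≤ C · B`.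
[cite: Dieudonne1971GroupesClassiques, Chap. II §5] -/
theorem v_lineRoot_frame_le (hvσ : ∀ x, Valued.v (σ x) = Valued.v x) {B C : ℤᵐ⁰} (hB1 : 1 ≤ B) (hC1 : 1 ≤ C) (hW : ∀ p q, Valued.v (wittFormOn e Han p q) ≤ B)
    {p : Fin N} (hp : ∀ u : Fin m, p ≠ e (Sum.inr (Sum.inl u))) {w : Fin N → K} {z : K} (hw : ∀ i, Valued.v (w i) ≤ C) (hz : Valued.v z ≤ C) (i j : Fin N) :
    Valued.v (lineRoot σ (wittFormOn e Han) (Pi.single p 1) w z i j) ≤ C * B := by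
  have hCB : 1 ≤ C * B := one_le_mul hC1 hB1
  have hrow : Valued.v (hermRow σ (wittFormOn e Han) (Pi.single p 1) j) ≤ 1 := by
    rw [hermRow_single_frame σ e hstd Han hp]; split_ifs
    · rw [map_one]
    · rw [map_zero]; exact zero_le
  have hsingle : Valued.v (Pi.single (M := fun _ : Fin N => K) p (1 : K) i) ≤ 1 := by
    by_cases h : i = p
    · subst h; rw [Pi.single_eq_same, map_one]
    · rw [Pi.single_eq_of_ne h, map_zero]; exact zero_le
  rw [lineRoot, Matrix.add_apply, Matrix.add_apply, Matrix.vecMulVec_apply, Matrix.vecMulVec_apply, Pi.sub_apply, Pi.smul_apply, smul_eq_mul]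
  have h1 : Valued.v ((1 : Matrix (Fin N) (Fin N) K) i j) ≤ C * B := by
    rw [Matrix.one_apply]; split_ifs
    · rw [map_one]; exact hCB
    · rw [map_zero]; exact zero_le
  refine (Valued.v.map_add _ _).trans (max_le ((Valued.v.map_add _ _).trans (max_le h1 ?_)) ?_)
  · rw [map_mul]
    calc Valued.v (w i) * Valued.v (hermRow σ (wittFormOn e Han) (Pi.single p 1) j) ≤ C * 1 := mul_le_mul' (hw i) hrow
      _ ≤ C * B := mul_le_mul' le_rfl hB1
  · rw [map_mul]
    calc Valued.v (Pi.single (M := fun _ : Fin N => K) p (1 : K) i) * Valued.v (z * hermRow σ (wittFormOn e Han) (Pi.single p 1) j - hermRow σ (wittFormOn e Han) w j)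
        ≤ 1 * (C * B) := by
          refine mul_le_mul' hsingle ((Valued.v.map_sub _ _).trans (max_le ?_ (v_hermRow_le σ e Han hvσ hW hw j)))
          rw [map_mul]
          calc Valued.v z * Valued.v (hermRow σ (wittFormOn e Han) (Pi.single p 1) j) ≤ C * 1 := mul_le_mul' hz hrow
            _ ≤ C * B := mul_le_mul' le_rfl hB1
      _ = C * B := one_mul _

include hstd in
/-- `v(lineProj_{e_a, e_b}(v)_i) ≤ C` for frame slots `a, b` and `v(v_i) ≤ C` (coefficients `h(e_b, v) = v_{rev b}`, `h(e_a, v) = v_{rev a}`).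
[cite: Dieudonne1971GroupesClassiques, Chap. II §5] -/
theorem v_lineProj_frame_le {a b : Fin N} (ha : ∀ u : Fin m, a ≠ e (Sum.inr (Sum.inl u))) (hb : ∀ u : Fin m, b ≠ e (Sum.inr (Sum.inl u)))
    {v : Fin N → K} {C : ℤᵐ⁰} (hv : ∀ i, Valued.v (v i) ≤ C) (i : Fin N) :
    Valued.v (lineProj σ (wittFormOn e Han) (Pi.single a 1) (Pi.single b 1) v i) ≤ C := by
  rw [lineProj, hermForm_single_frame_left σ e hstd Han hb, hermForm_single_frame_left σ e hstd Han ha, Pi.sub_apply, Pi.sub_apply, Pi.smul_apply, Pi.smul_apply,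
    smul_eq_mul, smul_eq_mul]
  have hs : ∀ c : Fin N, Valued.v (Pi.single (M := fun _ : Fin N => K) c (1 : K) i) ≤ 1 := fun c => by
    by_cases h : i = c
    · subst h; rw [Pi.single_eq_same, map_one]
    · rw [Pi.single_eq_of_ne h, map_zero]; exact zero_le_one
  refine (Valued.v.map_sub _ _).trans (max_le ((Valued.v.map_sub _ _).trans (max_le (hv i) ?_)) ?_)
  · rw [map_mul]; exact (mul_le_mul' (hv _) (hs a)).trans (le_of_eq (mul_one C))
  · rw [map_mul]; exact (mul_le_mul' (hv _) (hs b)).trans (le_of_eq (mul_one C))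

end Bounds

/-! ## §2 The elimination step with a near-maximal frame pivot -/

section Step

variable {K : Type*} [Field K] [Valued K ℤᵐ⁰] {σ : K →+* K} {N r m : ℕ} (e : WittIndex r m ≃ Fin N)
  (hstd : ∀ x, (e x).val = Sum.elim (fun i : Fin r => i.val) (Sum.elim (fun u : Fin m => r + u.val) (fun j : Fin r => r + m + j.val)) x)
  (Han : Matrix (Fin m) (Fin m) K)

include hstd in
/-- **THE BOUNDED ELIMINATION STEP.**  `g ∈ U(σ, W)`, `(s, t)` a frame × frame slot, `λ = g_{st} ≠ 0`, all entries of `g` and of `g⁻¹` bounded by `C · v(λ)` (`C ≥ 1`),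
`v(W) ≤ B` (`B ≥ 1`), `W` σ-hermitian, `det Han` a unit: there are `ω₁, ω₂ ∈ U(σ, W)` with entries bounded by `C · B` such that `q = ω₁⁻¹ g ω₂` satisfies
`q e_t = λ e_s` and `q e_{rev t} = (σλ)⁻¹ e_{rev s}`. [cite: BruhatTits1972, (4.4.3)] [cite: Dieudonne1971GroupesClassiques, Chap. II §5] -/
theorem exists_conj_eigen_of_frame_pivot (hσ : ∀ x, σ (σ x) = x) (hvσ : ∀ x, Valued.v (σ x) = Valued.v x)
    (hWh : ((wittFormOn e Han).map σ)ᵀ = wittFormOn e Han) (hHan : IsUnit Han.det) {B C : ℤᵐ⁰} (hB1 : 1 ≤ B) (hC1 : 1 ≤ C)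
    (hW : ∀ p q, Valued.v (wittFormOn e Han p q) ≤ B) (g : unitaryGroupOfForm σ (wittFormOn e Han)) {s t : Fin N}
    (hs : ∀ u : Fin m, s ≠ e (Sum.inr (Sum.inl u))) (ht : ∀ u : Fin m, t ≠ e (Sum.inr (Sum.inl u)))
    (hst : ((g : GL (Fin N) K) : Matrix (Fin N) (Fin N) K) s t ≠ 0)
    (hle : ∀ i j, Valued.v (((g : GL (Fin N) K) : Matrix (Fin N) (Fin N) K) i j) ≤ C * Valued.v (((g : GL (Fin N) K) : Matrix (Fin N) (Fin N) K) s t))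
    (hlei : ∀ i j, Valued.v ((((g⁻¹ : unitaryGroupOfForm σ (wittFormOn e Han)) : GL (Fin N) K) : Matrix (Fin N) (Fin N) K) i j) ≤
      C * Valued.v (((g : GL (Fin N) K) : Matrix (Fin N) (Fin N) K) s t)) :
    ∃ ω₁ ω₂ : unitaryGroupOfForm σ (wittFormOn e Han),
      (∀ i j, Valued.v (((ω₁ : GL (Fin N) K) : Matrix (Fin N) (Fin N) K) i j) ≤ C * B) ∧
      (∀ i j, Valued.v (((ω₂ : GL (Fin N) K) : Matrix (Fin N) (Fin N) K) i j) ≤ C * B) ∧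
      (((ω₁⁻¹ * g * ω₂ : unitaryGroupOfForm σ (wittFormOn e Han)) : GL (Fin N) K) : Matrix (Fin N) (Fin N) K) *ᵥ Pi.single t 1 =
        ((g : GL (Fin N) K) : Matrix (Fin N) (Fin N) K) s t • Pi.single s 1 ∧
      (((ω₁⁻¹ * g * ω₂ : unitaryGroupOfForm σ (wittFormOn e Han)) : GL (Fin N) K) : Matrix (Fin N) (Fin N) K) *ᵥ Pi.single (Fin.rev t) 1 =
        (σ (((g : GL (Fin N) K) : Matrix (Fin N) (Fin N) K) s t))⁻¹ • Pi.single (Fin.rev s) 1 := by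
  set A : Matrix (Fin N) (Fin N) K := ((g : GL (Fin N) K) : Matrix (Fin N) (Fin N) K) with hA
  have hgU : (A.map σ)ᵀ * (wittFormOn e Han) * A = (wittFormOn e Han) := mem_unitaryGroupOfForm_iff.1 g.2
  have hgiU : ((((g⁻¹ : unitaryGroupOfForm σ (wittFormOn e Han)) : GL (Fin N) K) : Matrix (Fin N) (Fin N) K).map σ)ᵀ * (wittFormOn e Han) *
      (((g⁻¹ : unitaryGroupOfForm σ (wittFormOn e Han)) : GL (Fin N) K) : Matrix (Fin N) (Fin N) K) = (wittFormOn e Han) := mem_unitaryGroupOfForm_iff.1 (g⁻¹).2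
  set lam : K := A s t with hlam
  have hlam0 : lam ≠ 0 := hst
  have hσlam0 : σ lam ≠ 0 := (map_ne_zero σ).2 hlam0
  have hvlam0 : Valued.v lam ≠ 0 := (Valuation.ne_zero_iff _).2 hlam0
  have hrs := frame_rev e hstd hs
  have hrt := frame_rev e hstd ht
  -- isotropy of the standard vectors involved
  have hxt : hermForm σ (wittFormOn e Han) (Pi.single t 1) (Pi.single t 1) = 0 := by
    rw [hermForm_single_single_frame σ e hstd Han ht, if_neg (ne_rev_of_frame e hstd ht)]
  have hyt : hermForm σ (wittFormOn e Han) (Pi.single (Fin.rev t) 1) (Pi.single (Fin.rev t) 1) = 0 := by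
    rw [hermForm_single_single_frame σ e hstd Han hrt, if_neg (ne_rev_of_frame e hstd hrt)]
  have hxtyt : hermForm σ (wittFormOn e Han) (Pi.single t 1) (Pi.single (Fin.rev t) 1) = 1 := by
    rw [hermForm_single_single_frame σ e hstd Han ht, if_pos rfl]
  have hx1 : hermForm σ (wittFormOn e Han) (Pi.single (Fin.rev s) 1) (Pi.single (Fin.rev s) 1) = 0 := by
    rw [hermForm_single_single_frame σ e hstd Han hrs, if_neg (ne_rev_of_frame e hstd hrs)]
  have hy1 : hermForm σ (wittFormOn e Han) (Pi.single s 1) (Pi.single s 1) = 0 := by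
    rw [hermForm_single_single_frame σ e hstd Han hs, if_neg (ne_rev_of_frame e hstd hs)]
  have hx1y1 : hermForm σ (wittFormOn e Han) (Pi.single (Fin.rev s) 1) (Pi.single s 1) = 1 := by
    rw [hermForm_single_single_frame σ e hstd Han hrs, if_pos (Fin.rev_rev s).symm]
  -- the column `u = g e_t` and `ẽ = λ⁻¹ u`
  set u : Fin N → K := fun i => A i t with hu
  have hgu : A *ᵥ Pi.single t 1 = u := K2E3WittFrameTools.mulVec_single_one A t
  set et : Fin N → K := lam⁻¹ • u with het
  have het_s : et s = 1 := by rw [het, Pi.smul_apply, smul_eq_mul]; exact inv_mul_cancel₀ hlam0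
  have het_bd : ∀ i, Valued.v (et i) ≤ C := fun i => by
    rw [het, Pi.smul_apply, smul_eq_mul, map_mul, map_inv₀]
    calc (Valued.v lam)⁻¹ * Valued.v (A i t) ≤ (Valued.v lam)⁻¹ * (C * Valued.v lam) := mul_le_mul' le_rfl (hle i t)
      _ = C := by rw [mul_comm C, ← mul_assoc, inv_mul_cancel₀ hvlam0, one_mul]
  have huu : hermForm σ (wittFormOn e Han) u u = 0 := by rw [← hgu, hermForm_mulVec σ hgU, hxt]
  have hetet : hermForm σ (wittFormOn e Han) et et = 0 := by rw [het, hermForm_smul_left_eq, hermForm_smul_right, huu, mul_zero, mul_zero]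
  have hx1et : hermForm σ (wittFormOn e Han) (Pi.single (Fin.rev s) 1) et = 1 := by rw [hermForm_single_frame_left σ e hstd Han hrs, Fin.rev_rev, het_s]
  have hu_eq : u = lam • et := by rw [het, smul_smul, mul_inv_cancel₀ hlam0, one_smul]
  -- `ω₁ = T_{e_{rev s}}(lineProj ẽ, h(e_s, ẽ))`: `e_{rev s} ↦ e_{rev s}`, `e_s ↦ ẽ`, bounded by `C · B`
  set ω₁ : GL (Fin N) K := lineRootGL σ (wittFormOn e Han) (hermForm σ (wittFormOn e Han) (Pi.single s 1) et) hx1 (hermForm_lineProj_left σ (wittFormOn e Han) hσ hWh hx1 hx1y1 et)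
    (hermForm_left_lineProj σ (wittFormOn e Han) hx1 hx1y1 et) with hω₁
  have hω₁U : ω₁ ∈ unitaryGroupOfForm σ (wittFormOn e Han) := lineRootGL_partner_mem σ (wittFormOn e Han) hσ hWh hx1 hy1 hx1y1 hetet hx1et
  have hω₁x : (ω₁ : Matrix (Fin N) (Fin N) K) *ᵥ Pi.single (Fin.rev s) 1 = Pi.single (Fin.rev s) 1 := by
    rw [hω₁, coe_lineRootGL]; exact lineRoot_partner_mulVec_left σ (wittFormOn e Han) hσ hWh hx1 hx1y1
  have hω₁y : (ω₁ : Matrix (Fin N) (Fin N) K) *ᵥ Pi.single s 1 = et := by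
    rw [hω₁, coe_lineRootGL]; exact lineRoot_partner_mulVec σ (wittFormOn e Han) hσ hWh hy1 hx1y1 hx1et
  have hω₁bd : ∀ i j, Valued.v ((ω₁ : Matrix (Fin N) (Fin N) K) i j) ≤ C * B := fun i j => by
    rw [hω₁, coe_lineRootGL]
    refine v_lineRoot_frame_le σ e hstd Han hvσ hB1 hC1 hW hrs (fun k => v_lineProj_frame_le σ e hstd Han hrs hs het_bd k) ?_ i j
    rw [hermForm_single_frame_left σ e hstd Han hs]; exact het_bd _
  -- `x₂′ = (σλ)⁻¹ g⁻¹ e_{rev s}` and `ω₂ = T_{e_t}(lineProj x₂′, h(e_{rev t}, x₂′))`: `e_t ↦ e_t`, `e_{rev t} ↦ x₂′`, bounded by `C · B`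
  set u2 : Fin N → K := fun i => (((g⁻¹ : unitaryGroupOfForm σ (wittFormOn e Han)) : GL (Fin N) K) : Matrix (Fin N) (Fin N) K) i (Fin.rev s) with hu2
  have hu2revt : u2 (Fin.rev t) = σ (A s t) := by
    show (((g⁻¹ : unitaryGroupOfForm σ (wittFormOn e Han)) : GL (Fin N) K) : Matrix (Fin N) (Fin N) K) (Fin.rev t) (Fin.rev s) = _
    rw [inv_apply_frame_frame σ e hstd Han hHan g hrt hrs, Fin.rev_rev, Fin.rev_rev]
  have hginv_u2 : (((g⁻¹ : unitaryGroupOfForm σ (wittFormOn e Han)) : GL (Fin N) K) : Matrix (Fin N) (Fin N) K) *ᵥ Pi.single (Fin.rev s) 1 = u2 :=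
    K2E3WittFrameTools.mulVec_single_one _ _
  set x2 : Fin N → K := (σ lam)⁻¹ • u2 with hx2
  have hx2_bd : ∀ i, Valued.v (x2 i) ≤ C := fun i => by
    rw [hx2, Pi.smul_apply, smul_eq_mul, map_mul, map_inv₀, hvσ]
    calc (Valued.v lam)⁻¹ * Valued.v (u2 i) ≤ (Valued.v lam)⁻¹ * (C * Valued.v lam) := mul_le_mul' le_rfl (hlei i (Fin.rev s))
      _ = C := by rw [mul_comm C, ← mul_assoc, inv_mul_cancel₀ hvlam0, one_mul]
  have hu2u2 : hermForm σ (wittFormOn e Han) u2 u2 = 0 := by rw [← hginv_u2, hermForm_mulVec σ hgiU, hx1]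
  have hx2x2 : hermForm σ (wittFormOn e Han) x2 x2 = 0 := by rw [hx2, hermForm_smul_left_eq, hermForm_smul_right, hu2u2, mul_zero, mul_zero]
  have htx2 : hermForm σ (wittFormOn e Han) (Pi.single t 1) x2 = 1 := by
    rw [hermForm_single_frame_left σ e hstd Han ht, hx2, Pi.smul_apply, smul_eq_mul, hu2revt]; exact inv_mul_cancel₀ hσlam0
  set ω₂ : GL (Fin N) K := lineRootGL σ (wittFormOn e Han) (hermForm σ (wittFormOn e Han) (Pi.single (Fin.rev t) 1) x2) hxt (hermForm_lineProj_left σ (wittFormOn e Han) hσ hWh hxt hxtyt x2)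
    (hermForm_left_lineProj σ (wittFormOn e Han) hxt hxtyt x2) with hω₂
  have hω₂U : ω₂ ∈ unitaryGroupOfForm σ (wittFormOn e Han) := lineRootGL_partner_mem σ (wittFormOn e Han) hσ hWh hxt hyt hxtyt hx2x2 htx2
  have hω₂x : (ω₂ : Matrix (Fin N) (Fin N) K) *ᵥ Pi.single t 1 = Pi.single t 1 := by
    rw [hω₂, coe_lineRootGL]; exact lineRoot_partner_mulVec_left σ (wittFormOn e Han) hσ hWh hxt hxtyt
  have hω₂y : (ω₂ : Matrix (Fin N) (Fin N) K) *ᵥ Pi.single (Fin.rev t) 1 = x2 := by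
    rw [hω₂, coe_lineRootGL]; exact lineRoot_partner_mulVec σ (wittFormOn e Han) hσ hWh hyt hxtyt htx2
  have hω₂bd : ∀ i j, Valued.v ((ω₂ : Matrix (Fin N) (Fin N) K) i j) ≤ C * B := fun i j => by
    rw [hω₂, coe_lineRootGL]
    refine v_lineRoot_frame_le σ e hstd Han hvσ hB1 hC1 hW ht (fun k => v_lineProj_frame_le σ e hstd Han ht hrt hx2_bd k) ?_ i j
    rw [hermForm_single_frame_left σ e hstd Han hrt, Fin.rev_rev]; exact hx2_bd _
  -- `ω₁⁻¹` undoes `ω₁` on `ẽ` and on `e_{rev s}`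
  have hω₁inv_et : ((ω₁⁻¹ : GL (Fin N) K) : Matrix (Fin N) (Fin N) K) *ᵥ et = Pi.single s 1 := by
    rw [← hω₁y, Matrix.mulVec_mulVec, ← Units.val_mul, inv_mul_cancel, Units.val_one, Matrix.one_mulVec]
  have hω₁inv_x : ((ω₁⁻¹ : GL (Fin N) K) : Matrix (Fin N) (Fin N) K) *ᵥ Pi.single (Fin.rev s) 1 = Pi.single (Fin.rev s) 1 := by
    conv_lhs => rw [← hω₁x]
    rw [Matrix.mulVec_mulVec, ← Units.val_mul, inv_mul_cancel, Units.val_one, Matrix.one_mulVec]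
  have hAu2 : A *ᵥ u2 = Pi.single (Fin.rev s) 1 := by
    rw [← hginv_u2, Matrix.mulVec_mulVec, hA, Subgroup.coe_inv, ← Units.val_mul, mul_inv_cancel, Units.val_one, Matrix.one_mulVec]
  refine ⟨⟨ω₁, hω₁U⟩, ⟨ω₂, hω₂U⟩, hω₁bd, hω₂bd, ?_, ?_⟩
  · rw [Subgroup.coe_mul, Subgroup.coe_mul, Subgroup.coe_inv, Units.val_mul, Units.val_mul, ← Matrix.mulVec_mulVec, ← Matrix.mulVec_mulVec]
    change ((ω₁⁻¹ : GL (Fin N) K) : Matrix (Fin N) (Fin N) K) *ᵥ (A *ᵥ ((ω₂ : Matrix (Fin N) (Fin N) K) *ᵥ Pi.single t 1)) = lam • Pi.single s 1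
    rw [hω₂x, hgu, hu_eq, Matrix.mulVec_smul, hω₁inv_et]
  · rw [Subgroup.coe_mul, Subgroup.coe_mul, Subgroup.coe_inv, Units.val_mul, Units.val_mul, ← Matrix.mulVec_mulVec, ← Matrix.mulVec_mulVec]
    change ((ω₁⁻¹ : GL (Fin N) K) : Matrix (Fin N) (Fin N) K) *ᵥ (A *ᵥ ((ω₂ : Matrix (Fin N) (Fin N) K) *ᵥ Pi.single (Fin.rev t) 1)) = (σ lam)⁻¹ • Pi.single (Fin.rev s) 1
    rw [hω₂y, hx2, Matrix.mulVec_smul, hAu2, Matrix.mulVec_smul, hω₁inv_x]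

end Step

end Summit.HodgeConjecture.HodgeConjecture.Cruxes.H413.K2E3WittBoundedStep

end
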